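import Mathlib.Analysis.Calculus.Deriv.ZPow
import Literature.Analysis.FunctionSpaces.TorusDerivSizeBounds
import Literature.MathematicalPhysics.KineticTheory.HardSphereEuler

/-!
# Third-order derivative bounds for the coefficient atoms of the σ-solution

Helper file for the line `log-lipschitz-budget` of the crux `ImplosionDichotomy.PolynomialCompression`
(stmt-AtomisticToContinuum-12587), stub `stub_logBudgetShadowing` (level-3 estimate). At a fixed time the
coefficients of the frozen operator are built from the atoms `ρ, θ, uₘ, ρ⁻¹, ζ(ρ), ρζ'(ρ)`; this file
records `Torus.HasDerivBoundsAt₃` for them (values and first derivatives bounded by a constant, second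
and third derivatives linearly in the sizes `S₂, S₃`), with EXPLICIT constants, the equation-of-state
composites carrying the SMALL constants `z₀ … z₄` (`|ζ - 1|, |ζ'|, …, |ζ''''|` along the solution).
Closure lemmas: `HasDerivBoundsAt₃.mul`, `.const_mul`, `hasDerivBoundsAt₃_comp`, `hasDerivBoundsAt₃_self`
(`TorusDerivSizeBounds`); sums are added here.
-/

noncomputable section

namespace Summit.AtomisticToContinuum.HydrodynamicLimit.Theorems

open Set
open scoped ContDiff
open Literature.MathematicalPhysics.KineticTheory Literature.Analysis.FunctionSpaces

/-! ## Sums and differences -/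

/-- Derivatives of orders `1, 2, 3` of a sum of smooth scalars, as functions. [folklore] -/
private theorem partialDeriv₃_add_fun {φ ψ : T3 → ℝ} (hφ : Torus.IsSmooth φ)
    (hψ : Torus.IsSmooth ψ) (i j k : Fin 3) :
    Torus.partialDeriv i (fun y => φ y + ψ y) =
        (fun y => Torus.partialDeriv i φ y + Torus.partialDeriv i ψ y) ∧
      Torus.partialDeriv j (Torus.partialDeriv i (fun y => φ y + ψ y)) =
        (fun y => Torus.partialDeriv j (Torus.partialDeriv i φ) y +
          Torus.partialDeriv j (Torus.partialDeriv i ψ) y) ∧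
      Torus.partialDeriv k (Torus.partialDeriv j (Torus.partialDeriv i (fun y => φ y + ψ y))) =
        (fun y => Torus.partialDeriv k (Torus.partialDeriv j (Torus.partialDeriv i φ)) y +
          Torus.partialDeriv k (Torus.partialDeriv j (Torus.partialDeriv i ψ)) y) := by
  have h1 : Torus.partialDeriv i (fun y => φ y + ψ y) =
      (fun y => Torus.partialDeriv i φ y + Torus.partialDeriv i ψ y) :=
    Torus.partialDeriv_add (hφ.isContDiff (by simp)) (hψ.isContDiff (by simp)) i
  have h2 : Torus.partialDeriv j (fun y => Torus.partialDeriv i φ y + Torus.partialDeriv i ψ y) =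
      (fun y => Torus.partialDeriv j (Torus.partialDeriv i φ) y +
        Torus.partialDeriv j (Torus.partialDeriv i ψ) y) :=
    Torus.partialDeriv_add ((hφ.partialDeriv i).isContDiff (by simp))
      ((hψ.partialDeriv i).isContDiff (by simp)) j
  have h3 : Torus.partialDeriv k (fun y => Torus.partialDeriv j (Torus.partialDeriv i φ) y +
      Torus.partialDeriv j (Torus.partialDeriv i ψ) y) =
      (fun y => Torus.partialDeriv k (Torus.partialDeriv j (Torus.partialDeriv i φ)) y +
        Torus.partialDeriv k (Torus.partialDeriv j (Torus.partialDeriv i ψ)) y) :=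
    Torus.partialDeriv_add (((hφ.partialDeriv i).partialDeriv j).isContDiff (by simp))
      (((hψ.partialDeriv i).partialDeriv j).isContDiff (by simp)) k
  exact ⟨h1, by rw [h1, h2], by rw [h1, h2, h3]⟩

/-- Sums of functions with third-order derivative bounds (constant `C + C'`). [folklore] -/
private theorem hasDerivBoundsAt₃_add {φ ψ : T3 → ℝ} {x : T3} {C C' S₂ S₃ : ℝ}
    (hφ : Torus.IsSmooth φ) (hψ : Torus.IsSmooth ψ)
    (h : Torus.HasDerivBoundsAt₃ φ x C S₂ S₃) (h' : Torus.HasDerivBoundsAt₃ ψ x C' S₂ S₃) :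
    Torus.HasDerivBoundsAt₃ (fun y => φ y + ψ y) x (C + C') S₂ S₃ where
  zero := (abs_add_le _ _).trans (add_le_add h.zero h'.zero)
  one i := by
    rw [(partialDeriv₃_add_fun hφ hψ i i i).1]
    exact (abs_add_le _ _).trans (add_le_add (h.one i) (h'.one i))
  two i j := by
    rw [(partialDeriv₃_add_fun hφ hψ i j j).2.1, add_mul]
    exact (abs_add_le _ _).trans (add_le_add (h.two i j) (h'.two i j))
  three i j k := by
    rw [(partialDeriv₃_add_fun hφ hψ i j k).2.2, add_mul]
    exact (abs_add_le _ _).trans (add_le_add (h.three i j k) (h'.three i j k))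

/-- Sums and differences of functions with third-order derivative bounds. [folklore] -/
theorem hasDerivBoundsAt₃_add_sub :
    ∀ {φ ψ : T3 → ℝ} {x : T3} {C C' S₂ S₃ : ℝ}, Torus.IsSmooth φ → Torus.IsSmooth ψ →
      Torus.HasDerivBoundsAt₃ φ x C S₂ S₃ → Torus.HasDerivBoundsAt₃ ψ x C' S₂ S₃ →
      Torus.HasDerivBoundsAt₃ (fun y => φ y + ψ y) x (C + C') S₂ S₃ ∧
        Torus.HasDerivBoundsAt₃ (fun y => φ y - ψ y) x (C + C') S₂ S₃ := by
  intro φ ψ x C C' S₂ S₃ hφ hψ h h'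
  refine ⟨hasDerivBoundsAt₃_add hφ hψ h h', ?_⟩
  have hn : Torus.HasDerivBoundsAt₃ (fun y => (-1) * ψ y) x C' S₂ S₃ := by
    have := h'.const_mul hψ (-1)
    rwa [abs_neg, abs_one, one_mul] at this
  have hsn : Torus.IsSmooth (fun y => (-1 : ℝ) * ψ y) := ContDiff.mul contDiff_const hψ
  have e : (fun y => φ y - ψ y) = fun y => φ y + (-1) * ψ y := by
    funext y; ring
  rw [e]
  exact hasDerivBoundsAt₃_add hφ hsn h hn

/-! ## The atoms -/

/-- `s⁻¹` and the first three derivatives of `s ↦ s⁻¹` are bounded by `6(1 + ρm⁻¹)⁴` on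
`s ≥ ρm > 0` (`|s⁻¹| ≤ ρm⁻¹`, `|(s⁻¹)'| = s⁻²`, `|(s⁻¹)''| = 2s⁻³`, `|(s⁻¹)'''| = 6s⁻⁴`).
[folklore] -/
private theorem inv_derivs_le {ρm s : ℝ} (hρm : 0 < ρm) (hs : ρm ≤ s) :
    |s⁻¹| ≤ 6 * (1 + ρm⁻¹) ^ 4 ∧ |deriv Inv.inv s| ≤ 6 * (1 + ρm⁻¹) ^ 4 ∧
    |deriv (deriv Inv.inv) s| ≤ 6 * (1 + ρm⁻¹) ^ 4 ∧
    |deriv (deriv (deriv Inv.inv)) s| ≤ 6 * (1 + ρm⁻¹) ^ 4 := by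
  have hs0 : 0 < s := hρm.trans_le hs
  have ht0 : 0 < s⁻¹ := inv_pos.2 hs0
  have htB : s⁻¹ ≤ ρm⁻¹ := (inv_le_inv₀ hs0 hρm).2 hs
  have hB : s⁻¹ ≤ 1 + ρm⁻¹ := htB.trans (by linarith)
  have hB1 : (1 : ℝ) ≤ 1 + ρm⁻¹ := by linarith [inv_pos.2 hρm]
  have h1 : deriv Inv.inv s = -(s⁻¹) ^ 2 := by
    have h := iter_deriv_inv 1 s
    simp only [Function.iterate_one, pow_one, Nat.factorial_one, Nat.cast_one, mul_one] at h
    rw [h]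
    norm_num
    norm_cast
  have h2 : deriv (deriv Inv.inv) s = 2 * (s⁻¹) ^ 3 := by
    rw [show deriv (deriv (Inv.inv : ℝ → ℝ)) s = deriv^[2] Inv.inv s from rfl,
      iter_deriv_inv 2 s]
    norm_num
    norm_cast
  have h3 : deriv (deriv (deriv Inv.inv)) s = -6 * (s⁻¹) ^ 4 := by
    rw [show deriv (deriv (deriv (Inv.inv : ℝ → ℝ))) s = deriv^[3] Inv.inv s from rfl,
      iter_deriv_inv 3 s]
    norm_num [Nat.factorial]
    norm_cast
  have p1 : s⁻¹ ≤ (1 + ρm⁻¹) ^ 4 := hB.trans (le_self_pow₀ hB1 (by norm_num))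
  have p2 : (s⁻¹) ^ 2 ≤ (1 + ρm⁻¹) ^ 4 :=
    (pow_le_pow_left₀ ht0.le hB 2).trans (pow_le_pow_right₀ hB1 (by norm_num))
  have p3 : (s⁻¹) ^ 3 ≤ (1 + ρm⁻¹) ^ 4 :=
    (pow_le_pow_left₀ ht0.le hB 3).trans (pow_le_pow_right₀ hB1 (by norm_num))
  have p4 : (s⁻¹) ^ 4 ≤ (1 + ρm⁻¹) ^ 4 := pow_le_pow_left₀ ht0.le hB 4
  have hP : 0 ≤ (1 + ρm⁻¹) ^ 4 := by positivity
  refine ⟨?_, ?_, ?_, ?_⟩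
  · rw [abs_of_pos ht0]; linarith
  · rw [h1, abs_neg, abs_of_nonneg (by positivity)]; linarith
  · rw [h2, abs_of_nonneg (by positivity)]; linarith
  · rw [h3, show -6 * s⁻¹ ^ 4 = -(6 * s⁻¹ ^ 4) by ring, abs_neg,
      abs_of_nonneg (by positivity)]
    linarith

/-- The unknown itself: constant `1 + A + M₁` from `|w x| ≤ A`, `|∂ᵢw x| ≤ M₁` (`A, M₁ ≥ 0`),
sizes enlarged to `S₂, S₃`. [folklore] -/
private theorem atom_self {w : T3 → ℝ} {x : T3} {A M₁ S₂ S₃ : ℝ} (hA0 : 0 ≤ A)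
    (hM₁ : 0 ≤ M₁) (hA : |w x| ≤ A) (hw₁ : ∀ i, |Torus.partialDeriv i w x| ≤ M₁)
    (h₂ : Torus.dsize₂ w x ≤ S₂) (h₃ : Torus.dsize₃ w x ≤ S₃) :
    Torus.HasDerivBoundsAt₃ w x (1 + A + M₁) S₂ S₃ :=
  ((Torus.hasDerivBoundsAt₃_self hA hw₁).mono_size h₂ h₃).mono
    (max_le (max_le (by linarith) (by linarith)) (by linarith))
    ((Torus.dsize₂_nonneg w x).trans h₂) ((Torus.dsize₃_nonneg w x).trans h₃)

/-- Composites `φ ∘ w` with `φ` smooth near the range: constant `K(1 + M₁)³`, sizes enlarged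
to `S₂, S₃`. [folklore] -/
private theorem atom_comp {φ : ℝ → ℝ} {V : Set ℝ} {w : T3 → ℝ} {x : T3} {K M₁ S₂ S₃ : ℝ}
    (hφ : ContDiffOn ℝ ∞ φ V) (hV : IsOpen V) (hw : Torus.IsSmooth w) (hwV : ∀ y, w y ∈ V)
    (hK₀ : ∀ y, |φ (w y)| ≤ K) (hK₁ : ∀ y, |deriv φ (w y)| ≤ K)
    (hK₂ : ∀ y, |deriv (deriv φ) (w y)| ≤ K)
    (hK₃ : ∀ y, |deriv (deriv (deriv φ)) (w y)| ≤ K) (hM0 : 0 ≤ M₁)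
    (hM₁ : ∀ y i, |Torus.partialDeriv i w y| ≤ M₁) (h₂ : Torus.dsize₂ w x ≤ S₂)
    (h₃ : Torus.dsize₃ w x ≤ S₃) :
    Torus.HasDerivBoundsAt₃ (fun z => φ (w z)) x (K * (1 + M₁) ^ 3) S₂ S₃ :=
  (Torus.hasDerivBoundsAt₃_comp hφ hV hw hwV hK₀ hK₁ hK₂ hK₃ hM0 hM₁ x).mono_size h₂ h₃

/-- `s ↦ s⁻¹` is smooth on `(0, ∞)`. [folklore] -/
private theorem contDiffOn_inv_Ioi' : ContDiffOn ℝ ∞ (Inv.inv : ℝ → ℝ) (Ioi 0) :=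
  (contDiffOn_inv ℝ).mono fun _ hs => ne_of_gt hs

/-- The inverse density `ρ⁻¹`: constant `6(1 + ρm⁻¹)⁴(1 + M₁)³`. [folklore] -/
private theorem atom_inv {ρ : T3 → ℝ} {x : T3} {ρm M₁ S₂ S₃ : ℝ} (hρ : Torus.IsSmooth ρ)
    (hρm : 0 < ρm) (hρb : ∀ y, ρm ≤ ρ y) (hM₁ : 0 ≤ M₁)
    (hdρ : ∀ y i, |Torus.partialDeriv i ρ y| ≤ M₁) (h₂ : Torus.dsize₂ ρ x ≤ S₂)
    (h₃ : Torus.dsize₃ ρ x ≤ S₃) :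
    Torus.HasDerivBoundsAt₃ (fun y => (ρ y)⁻¹) x (6 * (1 + ρm⁻¹) ^ 4 * (1 + M₁) ^ 3)
      S₂ S₃ :=
  atom_comp (φ := Inv.inv) contDiffOn_inv_Ioi' isOpen_Ioi hρ (fun y => hρm.trans_le (hρb y))
    (fun y => (inv_derivs_le hρm (hρb y)).1) (fun y => (inv_derivs_le hρm (hρb y)).2.1)
    (fun y => (inv_derivs_le hρm (hρb y)).2.2.1)
    (fun y => (inv_derivs_le hρm (hρb y)).2.2.2) hM₁ hdρ h₂ h₃

/-- **Atom bounds.** For smooth `ρ, θ` on `𝕋³` with `0 < ρm ≤ ρ ≤ ρM`, `|θ| ≤ θM`, `|∂ᵢρ|, |∂ᵢθ| ≤ M₁`,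
a law `ζ` smooth on an open `J ∋ ρ(y)` with `|ζ(ρ) - 1| ≤ z₀`, `|ζ'(ρ)| ≤ z₁`, `|ζ''(ρ)| ≤ z₂`,
`|ζ'''(ρ)| ≤ z₃`, `|ζ''''(ρ)| ≤ z₄` along `ρ`, and sizes `S₂ ≥ dsize₂ ρ, dsize₂ θ`, `S₃ ≥ dsize₃ ρ, dsize₃ θ`
at `x`: third-order derivative bounds at `x` for `ρ`, `θ`, `ρ⁻¹`, `ζ(ρ)`, `ζ(ρ) - 1` (small), `ρ ζ'(ρ)`
(small), `γ(ρ) = ζ(ρ) + ρζ'(ρ)`, `γ(ρ) - 1` (small), the density weight `A = θ γ(ρ)/ρ` and `θ ζ(ρ)`,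
with the displayed explicit constants (`P = (1 + M₁)³`). [folklore] -/
theorem shadow_atom_bounds :
    ∀ {ρ θ : T3 → ℝ} {ζ : ℝ → ℝ} {J : Set ℝ} {x : T3} {ρm ρM θM M₁ z₀ z₁ z₂ z₃ z₄ S₂ S₃ : ℝ},
      Torus.IsSmooth ρ → Torus.IsSmooth θ → IsOpen J → ContDiffOn ℝ (⊤ : ℕ∞) ζ J → (∀ y, ρ y ∈ J) →
      0 < ρm → (∀ y, ρm ≤ ρ y ∧ ρ y ≤ ρM) → (∀ y, |θ y| ≤ θM) → 0 ≤ M₁ →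
      (∀ y i, |Torus.partialDeriv i ρ y| ≤ M₁) → (∀ y i, |Torus.partialDeriv i θ y| ≤ M₁) →
      0 ≤ z₀ → 0 ≤ z₁ → 0 ≤ z₂ → 0 ≤ z₃ → 0 ≤ z₄ →
      (∀ y, |ζ (ρ y) - 1| ≤ z₀ ∧ |deriv ζ (ρ y)| ≤ z₁ ∧ |deriv (deriv ζ) (ρ y)| ≤ z₂ ∧
        |deriv (deriv (deriv ζ)) (ρ y)| ≤ z₃ ∧ |deriv (deriv (deriv (deriv ζ))) (ρ y)| ≤ z₄) →
      Torus.dsize₂ ρ x ≤ S₂ → Torus.dsize₂ θ x ≤ S₂ → Torus.dsize₃ ρ x ≤ S₃ → Torus.dsize₃ θ x ≤ S₃ →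
      Torus.HasDerivBoundsAt₃ ρ x (1 + ρM + M₁) S₂ S₃ ∧
      Torus.HasDerivBoundsAt₃ θ x (1 + θM + M₁) S₂ S₃ ∧
      Torus.HasDerivBoundsAt₃ (fun y => (ρ y)⁻¹) x (6 * (1 + ρm⁻¹) ^ 4 * (1 + M₁) ^ 3) S₂ S₃ ∧
      Torus.HasDerivBoundsAt₃ (fun y => ζ (ρ y)) x ((1 + z₀ + z₁ + z₂ + z₃) * (1 + M₁) ^ 3) S₂ S₃ ∧
      Torus.HasDerivBoundsAt₃ (fun y => ζ (ρ y) - 1) x ((z₀ + z₁ + z₂ + z₃) * (1 + M₁) ^ 3) S₂ S₃ ∧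
      Torus.HasDerivBoundsAt₃ (fun y => ρ y * deriv ζ (ρ y)) x
        (8 * (1 + ρM + M₁) * ((z₁ + z₂ + z₃ + z₄) * (1 + M₁) ^ 3)) S₂ S₃ ∧
      Torus.HasDerivBoundsAt₃ (fun y => ζ (ρ y) + ρ y * deriv ζ (ρ y)) x
        ((1 + z₀ + z₁ + z₂ + z₃) * (1 + M₁) ^ 3 + 8 * (1 + ρM + M₁) * ((z₁ + z₂ + z₃ + z₄) * (1 + M₁) ^ 3))
        S₂ S₃ ∧
      Torus.HasDerivBoundsAt₃ (fun y => ζ (ρ y) + ρ y * deriv ζ (ρ y) - 1) x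
        ((z₀ + z₁ + z₂ + z₃) * (1 + M₁) ^ 3 + 8 * (1 + ρM + M₁) * ((z₁ + z₂ + z₃ + z₄) * (1 + M₁) ^ 3))
        S₂ S₃ ∧
      Torus.HasDerivBoundsAt₃ (fun y => θ y * (ζ (ρ y) + ρ y * deriv ζ (ρ y)) / ρ y) x
        (8 * (8 * (1 + θM + M₁) *
          ((1 + z₀ + z₁ + z₂ + z₃) * (1 + M₁) ^ 3 + 8 * (1 + ρM + M₁) * ((z₁ + z₂ + z₃ + z₄) * (1 + M₁) ^ 3))) *
          (6 * (1 + ρm⁻¹) ^ 4 * (1 + M₁) ^ 3)) S₂ S₃ ∧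
      Torus.HasDerivBoundsAt₃ (fun y => θ y * ζ (ρ y)) x
        (8 * (1 + θM + M₁) * ((1 + z₀ + z₁ + z₂ + z₃) * (1 + M₁) ^ 3)) S₂ S₃ := by
  intro ρ θ ζ J x ρm ρM θM M₁ z₀ z₁ z₂ z₃ z₄ S₂ S₃ hρ hθ hJ hζ hρJ hρm hρb hθb hM₁ hdρ hdθ
    hz₀ hz₁ hz₂ hz₃ hz₄ hζb hS₂ρ hS₂θ hS₃ρ hS₃θ
  have hS₂0 : 0 ≤ S₂ := (Torus.dsize₂_nonneg ρ x).trans hS₂ρ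
  have hS₃0 : 0 ≤ S₃ := (Torus.dsize₃_nonneg ρ x).trans hS₃ρ
  have hρpos : ∀ y, 0 < ρ y := fun y => hρm.trans_le (hρb y).1
  have hρM : 0 ≤ ρM := (hρpos x).le.trans (hρb x).2
  have hθM : 0 ≤ θM := (abs_nonneg _).trans (hθb x)
  -- the unknowns and the inverse density
  have H1 : Torus.HasDerivBoundsAt₃ ρ x (1 + ρM + M₁) S₂ S₃ :=
    atom_self hρM hM₁ (by rw [abs_of_pos (hρpos x)]; exact (hρb x).2) (hdρ x) hS₂ρ hS₃ρ
  have H2 : Torus.HasDerivBoundsAt₃ θ x (1 + θM + M₁) S₂ S₃ :=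
    atom_self hθM hM₁ (hθb x) (hdθ x) hS₂θ hS₃θ
  have H3 : Torus.HasDerivBoundsAt₃ (fun y => (ρ y)⁻¹) x
      (6 * (1 + ρm⁻¹) ^ 4 * (1 + M₁) ^ 3) S₂ S₃ :=
    atom_inv hρ hρm (fun y => (hρb y).1) hM₁ hdρ hS₂ρ hS₃ρ
  -- the equation-of-state composites
  have hζ0 : ∀ y, |ζ (ρ y)| ≤ 1 + z₀ := fun y => by
    have h := abs_sub_abs_le_abs_sub (ζ (ρ y)) 1
    rw [abs_one] at h
    linarith [(hζb y).1]
  have H4 : Torus.HasDerivBoundsAt₃ (fun y => ζ (ρ y)) x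
      ((1 + z₀ + z₁ + z₂ + z₃) * (1 + M₁) ^ 3) S₂ S₃ :=
    atom_comp hζ hJ hρ hρJ (fun y => by linarith [hζ0 y]) (fun y => by linarith [(hζb y).2.1])
      (fun y => by linarith [(hζb y).2.2.1]) (fun y => by linarith [(hζb y).2.2.2.1]) hM₁ hdρ
      hS₂ρ hS₃ρ
  have hζ1 : ContDiffOn ℝ ∞ (fun s => ζ s - 1) J := hζ.sub contDiffOn_const
  have e1 : deriv (fun s => ζ s - 1) = deriv ζ := deriv_sub_const_fun 1
  have H5 : Torus.HasDerivBoundsAt₃ (fun y => ζ (ρ y) - 1) x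
      ((z₀ + z₁ + z₂ + z₃) * (1 + M₁) ^ 3) S₂ S₃ :=
    atom_comp hζ1 hJ hρ hρJ (fun y => by linarith [(hζb y).1])
      (fun y => by rw [e1]; linarith [(hζb y).2.1])
      (fun y => by rw [e1]; linarith [(hζb y).2.2.1])
      (fun y => by rw [e1]; linarith [(hζb y).2.2.2.1]) hM₁ hdρ hS₂ρ hS₃ρ
  have hdζ : ContDiffOn ℝ ∞ (deriv ζ) J := Torus.contDiffOn_deriv_of_isOpen hζ hJ
  have H6' : Torus.HasDerivBoundsAt₃ (fun y => deriv ζ (ρ y)) x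
      ((z₁ + z₂ + z₃ + z₄) * (1 + M₁) ^ 3) S₂ S₃ :=
    atom_comp hdζ hJ hρ hρJ (fun y => by linarith [(hζb y).2.1])
      (fun y => by linarith [(hζb y).2.2.1]) (fun y => by linarith [(hζb y).2.2.2.1])
      (fun y => by linarith [(hζb y).2.2.2.2]) hM₁ hdρ hS₂ρ hS₃ρ
  -- smoothness of the atoms
  have hsζ : Torus.IsSmooth (fun y => ζ (ρ y)) := Torus.IsSmooth.comp_of_contDiffOn hζ hρ hρJ
  have hsζ1 : Torus.IsSmooth (fun y => ζ (ρ y) - 1) :=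
    Torus.IsSmooth.comp_of_contDiffOn hζ1 hρ hρJ
  have hsdζ : Torus.IsSmooth (fun y => deriv ζ (ρ y)) :=
    Torus.IsSmooth.comp_of_contDiffOn hdζ hρ hρJ
  have hsinv : Torus.IsSmooth (fun y => (ρ y)⁻¹) :=
    Torus.IsSmooth.comp_of_contDiffOn (φ := Inv.inv) contDiffOn_inv_Ioi' hρ fun y => hρpos y
  have hs6 : Torus.IsSmooth (fun y => ρ y * deriv ζ (ρ y)) := ContDiff.mul hρ hsdζ
  have hs7 : Torus.IsSmooth (fun y => ζ (ρ y) + ρ y * deriv ζ (ρ y)) := ContDiff.add hsζ hs6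
  have hs9 : Torus.IsSmooth (fun y => θ y * (ζ (ρ y) + ρ y * deriv ζ (ρ y))) :=
    ContDiff.mul hθ hs7
  -- products and sums
  have H6 : Torus.HasDerivBoundsAt₃ (fun y => ρ y * deriv ζ (ρ y)) x
      (8 * (1 + ρM + M₁) * ((z₁ + z₂ + z₃ + z₄) * (1 + M₁) ^ 3)) S₂ S₃ :=
    H1.mul H6' hρ hsdζ hS₂0 hS₃0
  have H7 := hasDerivBoundsAt₃_add hsζ hs6 H4 H6
  have H8 : Torus.HasDerivBoundsAt₃ (fun y => ζ (ρ y) + ρ y * deriv ζ (ρ y) - 1) x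
      ((z₀ + z₁ + z₂ + z₃) * (1 + M₁) ^ 3 +
        8 * (1 + ρM + M₁) * ((z₁ + z₂ + z₃ + z₄) * (1 + M₁) ^ 3)) S₂ S₃ := by
    have e : (fun y => ζ (ρ y) + ρ y * deriv ζ (ρ y) - 1) =
        fun y => (ζ (ρ y) - 1) + ρ y * deriv ζ (ρ y) := by
      funext y; ring
    rw [e]
    exact hasDerivBoundsAt₃_add hsζ1 hs6 H5 H6
  have H9 : Torus.HasDerivBoundsAt₃ (fun y => θ y * (ζ (ρ y) + ρ y * deriv ζ (ρ y)) / ρ y) x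
      (8 * (8 * (1 + θM + M₁) *
        ((1 + z₀ + z₁ + z₂ + z₃) * (1 + M₁) ^ 3 +
          8 * (1 + ρM + M₁) * ((z₁ + z₂ + z₃ + z₄) * (1 + M₁) ^ 3))) *
        (6 * (1 + ρm⁻¹) ^ 4 * (1 + M₁) ^ 3)) S₂ S₃ := by
    have e : (fun y => θ y * (ζ (ρ y) + ρ y * deriv ζ (ρ y)) / ρ y) =
        fun y => (θ y * (ζ (ρ y) + ρ y * deriv ζ (ρ y))) * (ρ y)⁻¹ := by
      funext y; rw [div_eq_mul_inv]
    rw [e]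
    exact ((H2.mul H7 hθ hs7 hS₂0 hS₃0).mul H3 hs9 hsinv hS₂0 hS₃0)
  exact ⟨H1, H2, H3, H4, H5, H6, H7, H8, H9, H2.mul H4 hθ hsζ hS₂0 hS₃0⟩

end Summit.AtomisticToContinuum.HydrodynamicLimit.Theorems

end
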